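import Mathlib
import HarnessLib
import Summits.AtomisticToContinuum.FouriersLaw.Theses.StaticAbelianSqueeze

/-!
# Line `Sketch` of crux `UniformAbelianRegularity` (stmt-AtomisticToContinuum-13416): the post-crossing tail stub is
IMPLIED by the signed uniform tail (ST) of the twin cut
(`--supports` glue file proving the registered comparison stub `stub_postCrossingTailsOfUniformSignedTail`; closes nothing)

Two reductions of (R) are landed: (R) ⇐ ST (`stub_uniformAbelianRegularityOfUniformSignedTail`, p148211, twin line
`series-law-at-every-laplace-frequency`) and (R) ⇐ bulk–contact splice ∧ post-crossing tails (`stub_regularityOfSpliceAndTails`,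
p152607, this line).  This file records the one-line comparison between the two residual TAIL statements:

* (ST)  `∀ ε > 0 ∃ τ > 0 ∃ N₀ ∀ N ≥ N₀ ∀ t ≥ τ, |∫_{(t,∞)} c_N| ≤ εN` — signed tails from an `N`-INDEPENDENT time on;
* (K1)  `∀ c₀ > 0 ∀ ε > 0 ∃ N₀ ∀ N ≥ N₀ ∀ ξ ≥ c₀N, |∫_{(ξ,∞)} c_N| ≤ εN` — signed tails only after the LINEAR crossing time.

(ST) ⇒ (K1): for `N ≥ max N₀ ⌈τ/c₀⌉₊`, every `ξ ≥ c₀N` is `≥ τ`.  So this line's residual `stub_postCrossingTails` is weaker than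
the twin's `stub_uniformSignedTail`; what this line asks IN ADDITION is the bulk–contact splice (`stub_bulkContactSplice`),
which replaces the window `[τ, c₀N]` of (ST) by bulk spectral continuity at `0`.  No named fact; nothing here closes the item.
-/

noncomputable section

namespace Summit.AtomisticToContinuum.FouriersLaw.Theorems.UniformAbelianRegularity.ZeroMeanDyadicSplice

/-- **Registered comparison stub `stub_postCrossingTailsOfUniformSignedTail`: (ST) ⇒ (K1).** The signed uniform tail from an
`N`-independent time `τ` (the twin cut's residual `stub_uniformSignedTail`) implies the post-crossing signed tail bound of line
`Sketch` (`stub_postCrossingTails`): for `N ≥ max N₀ ⌈τ/c₀⌉₊` one has `c₀ N ≥ τ`. [folklore] -/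
theorem stub_postCrossingTailsOfUniformSignedTail :
    (∀ ω₂ lam β γ : ℝ, 0 < ω₂ → 0 < lam → 0 < β → 0 < γ → ∀ T : ℝ, 0 < T → ∀ ε : ℝ, 0 < ε → ∃ τ : ℝ, 0 < τ ∧ ∃ N₀ : ℕ, ∀ N : ℕ, N₀ ≤ N → ∀ t : ℝ, τ ≤ t → let J : Literature.MathematicalPhysics.KineticTheory.HeatConduction.PhaseSpace N → ℝ := fun z => ∑ i : Fin N, (Literature.MathematicalPhysics.KineticTheory.HeatConduction.pinnedChain ω₂ lam β γ).bondCurrent N i z; |∫ s in Set.Ioi t, ∫ z, J z * (∫ y, J y ∂((Literature.MathematicalPhysics.KineticTheory.HeatConduction.pinnedChain ω₂ lam β γ).transitionKernel N T T s.toNNReal z)) ∂((Literature.MathematicalPhysics.KineticTheory.HeatConduction.pinnedChain ω₂ lam β γ).gibbsMeasure N T)| ≤ ε * N) →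
    (∀ ω₂ lam β γ : ℝ, 0 < ω₂ → 0 < lam → 0 < β → 0 < γ → ∀ T : ℝ, 0 < T → ∀ c₀ : ℝ, 0 < c₀ → ∀ ε : ℝ, 0 < ε →
      ∃ N₀ : ℕ, ∀ N : ℕ, N₀ ≤ N → ∀ ξ : ℝ, c₀ * N ≤ ξ → let J : Literature.MathematicalPhysics.KineticTheory.HeatConduction.PhaseSpace N → ℝ := fun z => ∑ i : Fin N, (Literature.MathematicalPhysics.KineticTheory.HeatConduction.pinnedChain ω₂ lam β γ).bondCurrent N i z; |∫ s in Set.Ioi ξ, ∫ z, J z * (∫ y, J y ∂((Literature.MathematicalPhysics.KineticTheory.HeatConduction.pinnedChain ω₂ lam β γ).transitionKernel N T T s.toNNReal z)) ∂((Literature.MathematicalPhysics.KineticTheory.HeatConduction.pinnedChain ω₂ lam β γ).gibbsMeasure N T)| ≤ ε * N) := by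
  intro hST ω₂ lam β γ hω hl hβ hγ T hT c₀ hc₀ ε hε
  obtain ⟨τ, hτ, N₀, hN₀⟩ := hST ω₂ lam β γ hω hl hβ hγ T hT ε hε
  refine ⟨max N₀ ⌈τ / c₀⌉₊, fun N hN ξ hξ => ?_⟩
  have hN₀N : N₀ ≤ N := le_trans (le_max_left _ _) hN
  have hceil : (⌈τ / c₀⌉₊ : ℝ) ≤ N := by exact_mod_cast le_trans (le_max_right _ _) hN
  have hτN : τ ≤ c₀ * N := by
    have h1 : τ / c₀ ≤ N := (Nat.le_ceil _).trans hceil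
    rw [div_le_iff₀ hc₀] at h1
    linarith [mul_comm (N:ℝ) c₀]
  exact hN₀ N hN₀N ξ (hτN.trans hξ)

end Summit.AtomisticToContinuum.FouriersLaw.Theorems.UniformAbelianRegularity.ZeroMeanDyadicSplice

end
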